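import Summits.ValiantsHypothesis.ValiantsHypothesis.Theorems.LacunarySymmetroidMatrixDescartesCensusDoorA34StrataSubStrata

/-!
# `MatrixDescartes` census — DOOR A at `(3,4)`: the ISOTROPIC-CORE TOP-WINDOW LAW (the flag window is a binary form of the border: `≤ 4 < 5`)

HONEST FRAMING.  Object-search cell `pub-symmetroid`, engine seat `val-sym-eng-2` (g2); helper file beside the registered strata line
`Cruxes/DoorA34/Lines/strata.lean` on stmt-ValiantsHypothesis-19980 (`DoorA34 = PosRootLawAt 3 4 18`: OPEN, typed, never asserted here).
On the null-top stratum the determinant splits into blocks (`Census.det_pencil_nullTop_eq_blocks`, p561661/door-p3):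
`det F = det G + X^{d₃}·tr(adj G·S₃) + X^{2d₃}·tr(adj S₃·G)`.  Three steps down the descending flag of end coefficients (companions
`…SubStratumLift(Top)`, `…IsotropicCorner`) the kernel vector of `S₃` is isotropic for the whole core net — in coordinates with that vector
`= e₂`: every letter has zero corner `(S l)₂₂ = 0` (`l < 3`) and `S₃` is supported on the `{0,1}` block; then the top block vanishes
identically and the FLAG WINDOW `tr(adj G·S₃)` is what is left above the core.  This file proves a first structural BEYOND-DESCARTES
bound for that window:

* `trace_adjugate_mul_of_corner_eq_zero` — for symmetric `M` with `M₂₂ = 0` and symmetric `T` supported on the `{0,1}` block (any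
  commutative ring): `tr(adj M · T) = −(T₀₀·M₁₂² − 2·T₀₁·M₀₂·M₁₂ + T₁₁·M₀₂²)` — the window is (minus) the BINARY QUADRATIC FORM of `T` on
  the border `(M₁₂, −M₀₂)`;
* `card_posRoots_le_two_of_support_subset_three` (a non-zero polynomial supported on `≤ 3` exponents has `≤ 2` positive roots) and
  `card_posRoots_binaryForm_le_four` — **a non-zero binary quadratic form `a·g₁² + 2b·g₁g₂ + c·g₂²` of two real polynomials `g₁, g₂`
  supported on the same three exponents has AT MOST `4` distinct positive roots** (Descartes would allow `5`: six monomials): indefinite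
  ⇒ product of two trinomials of the pencil `span{g₁, g₂}`; definite ⇒ common roots of `g₁, g₂` only; degenerate ⇒ a square;
* `card_posRoots_topWindow_isotropicCore_le_four` — **ISOTROPIC-CORE TOP-WINDOW LAW**: for a real symmetric `(3,4)` pencil with
  `(S l)₂₂ = 0` (`l < 3`) and `S₃` supported on the `{0,1}` block, the flag window `tr(adj G·S₃)` is either identically zero or has at
  most `4` distinct positive roots.

READING (no claim beyond the theorems): in the hierarchical regime the isotropic-core sheet therefore carries at most
`Z(core) + 1 + 4` positive roots by window counting; with the located facts of DOOR-A34-ENG2G2-REPORT §4 (bordered `(3,3)` cores reach `8`,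
a bordered NINE-row was not found) this is `13`, TWO below the sheet's Descartes bound `15` — the first sheet of the flag where
«deficiency exactly one» would break.  NOTHING here bounds `ζ_sym(3,4)` (registers `18 ≤ ζ_sym(3,4) ≤ 19` unchanged); `DoorA34` and the
stubs stay OPEN; nothing on `MatrixDescartes` (stmt-ValiantsHypothesis-18050) or `VP ≠ VNP` — VP≠VNP not moved.

[folklore] Completing the square in a binary quadratic form; Descartes' bound for trinomials.
-/

-- `Summit.ValiantsHypothesis.ValiantsHypothesis.…` repeats a component by the D-0017 layout
-- (single-conjunct summit), which the `dupNamespace` linter flags; the name is mandated.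
set_option linter.dupNamespace false

namespace Summit.ValiantsHypothesis.ValiantsHypothesis.Theorems.LacunarySymmetroidMatrixDescartes.Census

open Polynomial Finset
open scoped BigOperators Polynomial Matrix

/-! ## The window is a binary quadratic form of the border -/

/-- For a symmetric `3 × 3` matrix `M` with zero corner `M₂₂ = 0` and a symmetric `T` supported on the `{0,1}` block (any commutative
ring): `tr(adj M · T) = −(T₀₀ M₁₂² − 2 T₀₁ M₀₂ M₁₂ + T₁₁ M₀₂²)`. [folklore] -/
theorem trace_adjugate_mul_of_corner_eq_zero {R : Type*} [CommRing R] (M T : Matrix (Fin 3) (Fin 3) R)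
    (hM : M.IsSymm) (hT : T.IsSymm) (hM22 : M 2 2 = 0) (hT02 : T 0 2 = 0) (hT12 : T 1 2 = 0) (hT22 : T 2 2 = 0) :
    (M.adjugate * T).trace = -(T 0 0 * M 1 2 ^ 2 - 2 * T 0 1 * M 0 2 * M 1 2 + T 1 1 * M 0 2 ^ 2) := by
  have h10 : M 1 0 = M 0 1 := by simpa using hM.apply 0 1
  have h20 : M 2 0 = M 0 2 := by simpa using hM.apply 0 2
  have h21 : M 2 1 = M 1 2 := by simpa using hM.apply 1 2
  have t10 : T 1 0 = T 0 1 := by simpa using hT.apply 0 1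
  have t20 : T 2 0 = T 0 2 := by simpa using hT.apply 0 2
  have t21 : T 2 1 = T 1 2 := by simpa using hT.apply 1 2
  rw [Matrix.trace_fin_three]
  simp only [Matrix.mul_apply, Fin.sum_univ_three, Matrix.adjugate_fin_three, Matrix.of_apply, Matrix.cons_val',
    Matrix.cons_val_zero, Matrix.cons_val_one, Matrix.cons_val_two, Matrix.empty_val', Matrix.cons_val_fin_one,
    Matrix.head_cons, Matrix.tail_cons, Matrix.head_fin_const]
  rw [h10, h20, h21, t10, t20, t21, hM22, hT02, hT12, hT22]
  ring

/-! ## Binary quadratic forms of two trinomials have at most four positive roots -/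

/-- A non-zero real polynomial supported on at most three exponents has at most two distinct positive roots (Descartes). [folklore] -/
theorem card_posRoots_le_two_of_support_subset_three (p : ℝ[X]) (hp : p ≠ 0) {k m n : ℕ}
    (hs : p.support ⊆ ({k, m, n} : Finset ℕ)) :
    (p.roots.toFinset.filter (fun t => 0 < t)).card ≤ 2 := by
  have h1 := Literature.Computability.AlgebraicComplexity.card_roots_toFinset_filter_pos_lt_card_support hp
  have h2 : p.support.card ≤ 3 := (Finset.card_le_card hs).trans Finset.card_le_three
  omega

/-- the positive roots of a product lie among the positive roots of the factors. [folklore] -/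
theorem card_posRoots_mul_le (p q : ℝ[X]) (h : p * q ≠ 0) :
    ((p * q).roots.toFinset.filter (fun t => 0 < t)).card
      ≤ (p.roots.toFinset.filter (fun t => 0 < t)).card + (q.roots.toFinset.filter (fun t => 0 < t)).card := by
  classical
  rw [Polynomial.roots_mul h, Multiset.toFinset_add, Finset.filter_union]
  exact Finset.card_union_le _ _

/-- linear combinations of two polynomials supported on `{k, m, n}` are supported there too. [folklore] -/
theorem support_linComb_subset {k m n : ℕ} (g₁ g₂ : ℝ[X]) (h₁ : g₁.support ⊆ ({k, m, n} : Finset ℕ))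
    (h₂ : g₂.support ⊆ ({k, m, n} : Finset ℕ)) (α β : ℝ) :
    (C α * g₁ + C β * g₂).support ⊆ ({k, m, n} : Finset ℕ) := by
  have hC : ∀ (γ : ℝ) (g : ℝ[X]), (C γ * g).support ⊆ g.support := fun γ g => by
    rw [← Polynomial.smul_eq_C_mul]; exact Polynomial.support_smul γ g
  refine Polynomial.support_add.trans (Finset.union_subset ?_ ?_)
  · exact (hC _ _).trans h₁
  · exact (hC _ _).trans h₂

/-- the positive roots of `p` lie among those of `q` when every root of `p` is a root of `q` (`q ≠ 0`). [folklore] -/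
theorem card_posRoots_le_of_roots_subset (p q : ℝ[X]) (hq : q ≠ 0) (h : ∀ t, p.IsRoot t → q.IsRoot t) (hp : p ≠ 0) :
    (p.roots.toFinset.filter (fun t => 0 < t)).card ≤ (q.roots.toFinset.filter (fun t => 0 < t)).card := by
  classical
  refine Finset.card_le_card fun t ht => ?_
  rw [Finset.mem_filter, Multiset.mem_toFinset, Polynomial.mem_roots hp] at ht
  rw [Finset.mem_filter, Multiset.mem_toFinset, Polynomial.mem_roots hq]
  exact ⟨h t ht.1, ht.2⟩

/-- **A binary quadratic form of two «trinomials» has at most four positive roots.**  If `g₁, g₂ ∈ ℝ[X]` are supported on the same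
three exponents `{k, m, n}` and `B = a·g₁² + 2b·g₁g₂ + c·g₂²` (written `C a * g₁^2 + 2 * C b * g₁ * g₂ + C c * g₂^2`) is not the zero polynomial, then `B` has at most `4` distinct positive
roots (its six monomials would allow `5` by Descartes). [folklore] -/
theorem card_posRoots_binaryForm_le_four {k m n : ℕ} (g₁ g₂ : ℝ[X]) (h₁ : g₁.support ⊆ ({k, m, n} : Finset ℕ))
    (h₂ : g₂.support ⊆ ({k, m, n} : Finset ℕ)) (a b c : ℝ)
    (hB : C a * g₁ ^ 2 + 2 * C b * g₁ * g₂ + C c * g₂ ^ 2 ≠ 0) :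
    ((C a * g₁ ^ 2 + 2 * C b * g₁ * g₂ + C c * g₂ ^ 2).roots.toFinset.filter (fun t => 0 < t)).card ≤ 4 := by
  classical
  set B : ℝ[X] := C a * g₁ ^ 2 + 2 * C b * g₁ * g₂ + C c * g₂ ^ 2 with hBdef
  -- a trinomial of the pencil has ≤ 2 positive roots
  have htri : ∀ α β : ℝ, C α * g₁ + C β * g₂ ≠ 0 →
      ((C α * g₁ + C β * g₂).roots.toFinset.filter (fun t => 0 < t)).card ≤ 2 := fun α β hne =>
    card_posRoots_le_two_of_support_subset_three _ hne (support_linComb_subset g₁ g₂ h₁ h₂ α β)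
  -- Case A: `a ≠ 0` — complete the square: `a·B = (a g₁ + b g₂)² − D·g₂²`, `D = b² − a c`
  by_cases ha : a ≠ 0
  · set D : ℝ := b ^ 2 - a * c with hD
    set ℓ : ℝ[X] := C a * g₁ + C b * g₂ with hℓ
    have hsq : C a * B = ℓ ^ 2 - C D * g₂ ^ 2 := by
      rw [hBdef, hℓ, hD, C_sub, C_mul, C_pow]
      ring
    have hrootsB : (B.roots.toFinset.filter (fun t => 0 < t)) = ((C a * B).roots.toFinset.filter (fun t => 0 < t)) := by
      rw [Polynomial.roots_C_mul _ ha]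
    rw [hrootsB, hsq]
    have hne : ℓ ^ 2 - C D * g₂ ^ 2 ≠ 0 := by rw [← hsq]; exact mul_ne_zero (by simpa using ha) hB
    rcases lt_trichotomy D 0 with hDneg | hD0 | hDpos
    · -- definite: roots are common roots of `ℓ` and `g₂`, in particular roots of `ℓ` (or of `g₂`)
      by_cases hg₂ : g₂ = 0
      · -- then the form is `ℓ²`
        have hℓne : ℓ ≠ 0 := by
          intro h0; apply hne; rw [h0, hg₂]; simp
        have hform : ℓ ^ 2 - C D * g₂ ^ 2 = ℓ * ℓ := by rw [hg₂]; ring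
        rw [hform]
        calc _ ≤ _ := card_posRoots_mul_le ℓ ℓ (by rw [← hform]; exact hne)
          _ ≤ 2 + 2 := Nat.add_le_add (htri a b hℓne) (htri a b hℓne)
          _ = 4 := rfl
      · have hsub : ∀ t, (ℓ ^ 2 - C D * g₂ ^ 2).IsRoot t → g₂.IsRoot t := by
          intro t ht
          rw [Polynomial.IsRoot, eval_sub, eval_pow, eval_mul, eval_C, eval_pow] at ht
          have h0 : (eval t ℓ) ^ 2 + (-D) * (eval t g₂) ^ 2 = 0 := by linarith
          have hD' : 0 < -D := by linarith
          have hg : (eval t g₂) ^ 2 = 0 := by nlinarith [sq_nonneg (eval t ℓ), sq_nonneg (eval t g₂)]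
          exact pow_eq_zero_iff (n := 2) (by norm_num) |>.mp hg
        have hg₂' : C (0 : ℝ) * g₁ + C 1 * g₂ ≠ 0 := by simpa using hg₂
        calc _ ≤ (g₂.roots.toFinset.filter (fun t => 0 < t)).card :=
              card_posRoots_le_of_roots_subset _ _ hg₂ hsub hne
          _ = ((C (0 : ℝ) * g₁ + C 1 * g₂).roots.toFinset.filter (fun t => 0 < t)).card := by simp
          _ ≤ 2 := htri 0 1 hg₂'
          _ ≤ 4 := by norm_num
    · -- degenerate: a square
      have hform : ℓ ^ 2 - C D * g₂ ^ 2 = ℓ * ℓ := by rw [hD0]; simp [sq]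
      have hℓne : ℓ ≠ 0 := by intro h0; apply hne; rw [hform, h0, mul_zero]
      rw [hform]
      calc _ ≤ _ := card_posRoots_mul_le ℓ ℓ (by rw [← hform]; exact hne)
        _ ≤ 2 + 2 := Nat.add_le_add (htri a b hℓne) (htri a b hℓne)
        _ = 4 := rfl
    · -- indefinite: product of two trinomials of the pencil
      set s : ℝ := Real.sqrt D with hs
      have hs2 : s * s = D := Real.mul_self_sqrt hDpos.le
      set ℓ₁ : ℝ[X] := C a * g₁ + C (b - s) * g₂ with hℓ₁
      set ℓ₂ : ℝ[X] := C a * g₁ + C (b + s) * g₂ with hℓ₂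
      have hform : ℓ ^ 2 - C D * g₂ ^ 2 = ℓ₁ * ℓ₂ := by
        rw [hℓ, hℓ₁, hℓ₂, ← hs2, C_mul, C_sub, C_add]
        ring
      rw [hform]
      have hne' : ℓ₁ * ℓ₂ ≠ 0 := by rw [← hform]; exact hne
      have h1ne : ℓ₁ ≠ 0 := left_ne_zero_of_mul hne'
      have h2ne : ℓ₂ ≠ 0 := right_ne_zero_of_mul hne'
      calc _ ≤ _ := card_posRoots_mul_le ℓ₁ ℓ₂ hne'
        _ ≤ 2 + 2 := Nat.add_le_add (htri a (b - s) h1ne) (htri a (b + s) h2ne)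
        _ = 4 := rfl
  · push Not at ha
    -- Case B: `a = 0`, `c ≠ 0` — the same with the roles of `g₁, g₂` exchanged
    by_cases hc : c ≠ 0
    · set D : ℝ := b ^ 2 with hD
      set ℓ : ℝ[X] := C c * g₂ + C b * g₁ with hℓ
      have hsq : C c * B = ℓ ^ 2 - C D * g₁ ^ 2 := by
        rw [hBdef, hℓ, hD, ha, C_pow, C_0, zero_mul, zero_add]
        ring
      have hrootsB : (B.roots.toFinset.filter (fun t => 0 < t)) = ((C c * B).roots.toFinset.filter (fun t => 0 < t)) := by
        rw [Polynomial.roots_C_mul _ hc]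
      rw [hrootsB, hsq]
      have hne : ℓ ^ 2 - C D * g₁ ^ 2 ≠ 0 := by rw [← hsq]; exact mul_ne_zero (by simpa using hc) hB
      have htri' : ∀ α β : ℝ, C α * g₂ + C β * g₁ ≠ 0 →
          ((C α * g₂ + C β * g₁).roots.toFinset.filter (fun t => 0 < t)).card ≤ 2 := fun α β hne0 => by
        have := htri β α (by rw [add_comm]; exact hne0)
        rwa [add_comm] at this
      rcases eq_or_lt_of_le (sq_nonneg b) with hD0 | hDpos
      · have hD0' : D = 0 := by rw [hD]; exact hD0.symm
        have hform : ℓ ^ 2 - C D * g₁ ^ 2 = ℓ * ℓ := by rw [hD0']; simp [sq]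
        have hℓne : ℓ ≠ 0 := by intro h0; apply hne; rw [hform, h0, mul_zero]
        rw [hform]
        calc _ ≤ _ := card_posRoots_mul_le ℓ ℓ (by rw [← hform]; exact hne)
          _ ≤ 2 + 2 := Nat.add_le_add (htri' c b hℓne) (htri' c b hℓne)
          _ = 4 := rfl
      · have hDpos' : 0 < D := by rw [hD]; exact hDpos
        set s : ℝ := Real.sqrt D with hs
        have hs2 : s * s = D := Real.mul_self_sqrt hDpos'.le
        set ℓ₁ : ℝ[X] := C c * g₂ + C (b - s) * g₁ with hℓ₁
        set ℓ₂ : ℝ[X] := C c * g₂ + C (b + s) * g₁ with hℓ₂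
        have hform : ℓ ^ 2 - C D * g₁ ^ 2 = ℓ₁ * ℓ₂ := by
          rw [hℓ, hℓ₁, hℓ₂, ← hs2, C_mul, C_sub, C_add]
          ring
        rw [hform]
        have hne' : ℓ₁ * ℓ₂ ≠ 0 := by rw [← hform]; exact hne
        calc _ ≤ _ := card_posRoots_mul_le ℓ₁ ℓ₂ hne'
          _ ≤ 2 + 2 := Nat.add_le_add (htri' c (b - s) (left_ne_zero_of_mul hne'))
              (htri' c (b + s) (right_ne_zero_of_mul hne'))
          _ = 4 := rfl
    · push Not at hc
      -- Case C: `a = c = 0`: `B = 2b·g₁·g₂`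
      have hform : B = (C (2 * b) * g₁) * g₂ := by
        rw [hBdef, ha, hc, C_mul, C_0, zero_mul, zero_mul, zero_add, add_zero, C_ofNat]
      have hne' : (C (2 * b) * g₁) * g₂ ≠ 0 := by rw [← hform]; exact hB
      rw [hform]
      have hb2 : C (2 * b) * g₁ ≠ 0 := left_ne_zero_of_mul hne'
      have hg₂ : g₂ ≠ 0 := right_ne_zero_of_mul hne'
      have e1 : C (2 * b) * g₁ = C (2 * b) * g₁ + C 0 * g₂ := by simp
      have e2 : g₂ = C 0 * g₁ + C 1 * g₂ := by simp
      calc _ ≤ _ := card_posRoots_mul_le _ _ hne'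
        _ ≤ 2 + 2 := by
            refine Nat.add_le_add ?_ ?_
            · rw [e1]; exact htri (2 * b) 0 (by rw [← e1]; exact hb2)
            · have := htri 0 1 (by rw [← e2]; exact hg₂)
              rw [← e2] at this; exact this
        _ = 4 := rfl

/-! ## The pencil statement -/

/-- an entry of the core pencil is the «trinomial» `Σ_l X^{d l}·C((S l) i j)`, supported on `{d 0, d 1, d 2}`. [folklore] -/
theorem support_corePencil_apply_subset (d : Fin 4 → ℕ) (S : Fin 4 → Matrix (Fin 3) (Fin 3) ℝ) (i j : Fin 3) :
    ((∑ l : Fin 3, (X : ℝ[X]) ^ d (Fin.castSucc l) • (S (Fin.castSucc l)).map C) i j).support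
      ⊆ ({d 0, d 1, d 2} : Finset ℕ) := by
  have hsum : (∑ l : Fin 3, (X : ℝ[X]) ^ d (Fin.castSucc l) • (S (Fin.castSucc l)).map C) i j
      = (X : ℝ[X]) ^ d 0 * C (S 0 i j) + (X : ℝ[X]) ^ d 1 * C (S 1 i j) + (X : ℝ[X]) ^ d 2 * C (S 2 i j) := by
    simp only [Matrix.sum_apply, Matrix.smul_apply, Matrix.map_apply, smul_eq_mul, Fin.sum_univ_three,
      Fin.castSucc_zero, Fin.castSucc_one]
    rfl
  rw [hsum]
  have hX : ∀ (n : ℕ) (r : ℝ), ((X : ℝ[X]) ^ n * C r).support ⊆ ({n} : Finset ℕ) := by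
    intro n r; rw [mul_comm]; exact Polynomial.support_C_mul_X_pow_subset n r
  refine Polynomial.support_add.trans (Finset.union_subset (Polynomial.support_add.trans (Finset.union_subset ?_ ?_)) ?_)
  · exact (hX _ _).trans (by simp)
  · exact (hX _ _).trans (by simp)
  · exact (hX _ _).trans (by simp)

/-- **ISOTROPIC-CORE TOP-WINDOW LAW.**  For a real symmetric `(3,4)` pencil whose core letters have zero corner `(S l)₂₂ = 0`
(`l < 3`) and whose top letter is supported on the `{0,1}` block (`(S 3) i 2 = 0`), the flag window `tr(adj G · S₃)` of the null-top
block anatomy is either the zero polynomial or has AT MOST `4` distinct positive roots (its six monomials would allow `5`). [folklore] -/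
theorem card_posRoots_topWindow_isotropicCore_le_four (d : Fin 4 → ℕ) (S : Fin 4 → Matrix (Fin 3) (Fin 3) ℝ)
    (hS : ∀ l, (S l).IsSymm) (hcorner : ∀ l : Fin 3, S (Fin.castSucc l) 2 2 = 0) (htop : ∀ i, S 3 i 2 = 0)
    (hne : ((∑ l : Fin 3, (X : ℝ[X]) ^ d (Fin.castSucc l) • (S (Fin.castSucc l)).map C).adjugate * (S 3).map C).trace ≠ 0) :
    ((((∑ l : Fin 3, (X : ℝ[X]) ^ d (Fin.castSucc l) • (S (Fin.castSucc l)).map C).adjugate * (S 3).map C).trace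
        ).roots.toFinset.filter (fun t => 0 < t)).card ≤ 4 := by
  classical
  set G : Matrix (Fin 3) (Fin 3) ℝ[X] := ∑ l : Fin 3, (X : ℝ[X]) ^ d (Fin.castSucc l) • (S (Fin.castSucc l)).map C with hG
  set T : Matrix (Fin 3) (Fin 3) ℝ[X] := (S 3).map C with hT
  have hGsymm : G.IsSymm := by
    have hl : ∀ l : Fin 3, ((X : ℝ[X]) ^ d (Fin.castSucc l) • (S (Fin.castSucc l)).map C).IsSymm := fun l =>
      ((hS (Fin.castSucc l)).map C).smul _
    rw [hG]
    unfold Matrix.IsSymm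
    rw [Matrix.transpose_sum]
    exact Finset.sum_congr rfl fun l _ => hl l
  have hTsymm : T.IsSymm := by
    unfold Matrix.IsSymm; ext i j
    rw [Matrix.transpose_apply, hT, Matrix.map_apply, Matrix.map_apply,
      show S 3 j i = S 3 i j from by simpa using (hS 3).apply i j]
  have hG22 : G 2 2 = 0 := by
    simp only [hG, Matrix.sum_apply, Matrix.smul_apply, Matrix.map_apply, hcorner, map_zero, smul_zero,
      Finset.sum_const_zero]
  have hT02 : T 0 2 = 0 := by rw [hT, Matrix.map_apply, htop 0, map_zero]
  have hT12 : T 1 2 = 0 := by rw [hT, Matrix.map_apply, htop 1, map_zero]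
  have hT22 : T 2 2 = 0 := by rw [hT, Matrix.map_apply, htop 2, map_zero]
  have hid := trace_adjugate_mul_of_corner_eq_zero G T hGsymm hTsymm hG22 hT02 hT12 hT22
  -- rewrite the window as (minus) a binary form of the two border trinomials `g₁ = G₁₂`, `g₂ = G₀₂`
  have hT00 : T 0 0 = C (S 3 0 0) := by rw [hT, Matrix.map_apply]
  have hT01 : T 0 1 = C (S 3 0 1) := by rw [hT, Matrix.map_apply]
  have hT11 : T 1 1 = C (S 3 1 1) := by rw [hT, Matrix.map_apply]
  have hform : (G.adjugate * T).trace
      = C (-1 : ℝ) * (C (S 3 0 0) * (G 1 2) ^ 2 + 2 * C (-(S 3 0 1)) * (G 1 2) * (G 0 2) + C (S 3 1 1) * (G 0 2) ^ 2) := by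
    rw [hid, hT00, hT01, hT11, C_neg, C_neg, C_1]
    ring
  have hne' : C (S 3 0 0) * (G 1 2) ^ 2 + 2 * C (-(S 3 0 1)) * (G 1 2) * (G 0 2) + C (S 3 1 1) * (G 0 2) ^ 2 ≠ 0 := by
    intro h0; apply hne; rw [hform, h0, mul_zero]
  rw [hform, Polynomial.roots_C_mul _ (by norm_num : (-1 : ℝ) ≠ 0)]
  exact card_posRoots_binaryForm_le_four (G 1 2) (G 0 2) (support_corePencil_apply_subset d S 1 2)
    (support_corePencil_apply_subset d S 0 2) _ _ _ hne'

end Summit.ValiantsHypothesis.ValiantsHypothesis.Theorems.LacunarySymmetroidMatrixDescartes.Census
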